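import Literature.IUT.HodgeTheaters.PuncturedEllipticProLModelXbar
import HarnessLib

/-!
# An infinite pro-`l` model of [IUTchI] §1, part 10: `Ker(Δ_X̲ ↠ Δ_X̲^{ab} ⊗ ℤ/l)` computed — `[Δ_X̲ : Ker] = l^{l+1}`

Mochizuki, *Inter-universal Teichmüller theory I*, kurims manuscript (May 2020), §1 p. 37 l. 31 ("`Δ_X̲ ↠ Δ_X̲^{ab} ⊗
(ℤ/lℤ)`"; for the genuine `X̲` — genus `1`, `l` cusps — this is `(ℤ/lℤ)^{l+1}`) ([IUTchI] §1 p.37) [claim: Mochizuki2012,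
status: disputed] (D-0012 claim key; series status DISPUTED — WITNESS-class PROOF-ONLY module; nothing of the series is
asserted, no side is taken on [IUTchIII] Cor. 3.12).

Cell abc-iut, seat abc-iut-L5-d4, row R45 «COR12-MODL-LAWS-DERIVE@M_l», brick B0 (the Frattini count on the model
side of the shadow comparison `Δ_X̲′/Φ_l ≅ W/Φ_l(W)`).  At the pro-`l` datum `ProLModel.datum l h5` (parts 1–9), with
`W = Δ_X̲ = N × lℤ_l` abelian (part 6):
* `mem_modLKer_datum_iff` — `Ker(Δ_X̲ ↠ Δ_X̲^{ab} ⊗ ℤ/l) = {(v, a^s) ∈ W : v ∈ l·N, s ∈ l²ℤ_l}` (coordinates of `v`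
  vanish mod `l`; `s` vanishes mod `l²`);
* **`modLKer_relIndex_datum` — `[Δ_X̲ : Ker(Δ_X̲ ↠ Δ_X̲^{ab} ⊗ ℤ/l)] = l^{l+1}`**, via the surjection
  `W ↠ (ℤ/l)^{ℤ/l} × ℤ/l`, `(v, a^{l t}) ↦ (v mod l, t mod l)` — the model-side twin of abc-iut-L5-t1's free-side
  count `IsFreeProOn.index_modPowCommutatorClosure_eq` at rank `l + 1` (Schreier) for a `GeomOrigin` datum.
HONEST LABEL: semi-synthetic model (`G_k = 1`); consistency/derivation device; no `sorry`; symbolic prime `l`.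
-/

noncomputable section

namespace Literature.IUT.HodgeTheaters

namespace PuncturedEllipticData

namespace ProLModel

open DihedralGroup _root_.Topology Literature.AnabelianGeometry.AbsoluteAnabelian
open scoped Pointwise commutatorElement

variable (l : ℕ) [Fact l.Prime]

/-! ### Division by `l` on `lℤ_l` -/

/-- `x ≡ 0 (mod l)` means `x = l·t`. [folklore] -/
private theorem exists_eq_mul_of_toZMod_eq_zero'' {x : ℤ_[l]} (hx : PadicInt.toZMod x = 0) :
    ∃ t : ℤ_[l], x = l * t := by
  have hx' : x ∈ RingHom.ker (PadicInt.toZMod (p := l)) := hx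
  rw [PadicInt.ker_toZMod, PadicInt.maximalIdeal_eq_span_p, Ideal.mem_span_singleton'] at hx'
  obtain ⟨t, ht⟩ := hx'
  exact ⟨t, by rw [← ht, mul_comm]⟩

/-- `l ≠ 0` in `ℤ_l`. [folklore] -/
private theorem natCast_l_ne_zero : (l : ℤ_[l]) ≠ 0 :=
  Nat.cast_ne_zero.mpr (Fact.out : l.Prime).ne_zero

/-- The quotient `s / l` of an element `s ≡ 0 (mod l)` (by choice; `l · quot = s`). [claim: Mochizuki2012, status: disputed] -/
theorem quot_spec {s : ℤ_[l]} (hs : PadicInt.toZMod s = 0) :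
    s = l * Classical.choose (exists_eq_mul_of_toZMod_eq_zero'' l hs) :=
  Classical.choose_spec (exists_eq_mul_of_toZMod_eq_zero'' l hs)

/-- Uniqueness of the quotient: `l t = l t′ ⇒ t = t′`. [claim: Mochizuki2012, status: disputed] -/
theorem quot_unique {s t : ℤ_[l]} (hs : PadicInt.toZMod s = 0) (ht : s = l * t) :
    Classical.choose (exists_eq_mul_of_toZMod_eq_zero'' l hs) = t :=
  mul_left_cancel₀ (natCast_l_ne_zero l) ((quot_spec l hs).symm.trans ht)

/-- `toZModPow 2 (l·t) = 0 ↔ t ≡ 0 (mod l)`. [folklore] -/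
private theorem toZModPow_two_mul_eq_zero_iff (t : ℤ_[l]) :
    PadicInt.toZModPow 2 ((l : ℤ_[l]) * t) = 0 ↔ PadicInt.toZMod t = 0 := by
  rw [← RingHom.mem_ker, PadicInt.ker_toZModPow, Ideal.mem_span_singleton', ← RingHom.mem_ker, PadicInt.ker_toZMod,
    PadicInt.maximalIdeal_eq_span_p, Ideal.mem_span_singleton']
  constructor
  · rintro ⟨a, ha⟩
    refine ⟨a, mul_left_cancel₀ (natCast_l_ne_zero l) ?_⟩
    rw [← ha, pow_two]; ring
  · rintro ⟨a, ha⟩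
    exact ⟨a, by rw [← ha, pow_two]; ring⟩

/-- `toZModPow 2 : ℤ_l → ℤ/l²` is continuous (its kernel is the open ball of radius `l⁻¹`). [folklore] -/
private theorem continuous_toZModPow_two : Continuous (PadicInt.toZModPow 2 : ℤ_[l] → ZMod (l ^ 2)) := by
  have hp : (1 : ℝ) < l := by exact_mod_cast (Fact.out : l.Prime).one_lt
  refine continuous_of_continuousAt_zero (PadicInt.toZModPow (p := l) 2) ?_
  rw [ContinuousAt, map_zero, nhds_discrete (ZMod (l ^ 2)), Filter.tendsto_pure]
  have hr : (0 : ℝ) < (l : ℝ) ^ (-(1 : ℤ)) := by positivity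
  filter_upwards [Metric.ball_mem_nhds (0 : ℤ_[l]) hr] with x hx
  rw [Metric.mem_ball, dist_zero_right] at hx
  have hle : ‖x‖ ≤ (l : ℝ) ^ (-(2 : ℕ) : ℤ) := by
    rw [PadicInt.norm_le_pow_iff_norm_lt_pow_add_one]
    convert hx using 2
    norm_num
  rw [PadicInt.norm_le_pow_iff_mem_span_pow, ← PadicInt.ker_toZModPow, RingHom.mem_ker] at hle
  exact hle

/-! ### `Ker(Δ_X̲ ↠ Δ_X̲^{ab} ⊗ ℤ/l)` at the datum -/

/-- **`Ker(Δ_X̲ ↠ Δ_X̲^{ab} ⊗ ℤ/l) = {(v, a^s) ∈ Π_X̲ : v ∈ l·N, s ∈ l²ℤ_l}`** at the pro-`l` datum.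
([IUTchI] §1 p.37) [claim: Mochizuki2012, status: disputed] -/
theorem mem_modLKer_datum_iff (h5 : 5 ≤ l) (g : P l) :
    g ∈ (datum l h5).modLKer ↔ g ∈ PiXm l ⊓ PiCbarm l ∧ (∀ m, PadicInt.toZMod (Multiplicative.toAdd g.left m) = 0) ∧
      PadicInt.toZModPow 2 (Multiplicative.toAdd g.right.left) = 0 := by
  classical
  constructor
  · intro hg
    -- the closed subgroup cut out by the conditions contains the commutators and the `l`-th powers of `W`
    let K : Subgroup (P l) :=
      { carrier := {g | g ∈ PiXm l ⊓ PiCbarm l ∧ (∀ m, PadicInt.toZMod (Multiplicative.toAdd g.left m) = 0) ∧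
          PadicInt.toZModPow 2 (Multiplicative.toAdd g.right.left) = 0}
        one_mem' := ⟨Subgroup.one_mem _, fun m => by rw [SemidirectProduct.one_left, toAdd_one, Pi.zero_apply, map_zero],
          by rw [SemidirectProduct.one_right, SemidirectProduct.one_left, toAdd_one, map_zero]⟩
        mul_mem' := fun {a b} ha hb => ⟨Subgroup.mul_mem _ ha.1 hb.1, fun m => by
            rw [left_mul_of_mem_PiXbar l ha.1, toAdd_mul, Pi.add_apply, map_add, ha.2.1 m, hb.2.1 m, add_zero],
          by rw [right_left_mul l ha.1.1, toAdd_mul, map_add, ha.2.2, hb.2.2, add_zero]⟩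
        inv_mem' := fun {a} ha => ⟨Subgroup.inv_mem _ ha.1, fun m => by
            have h := left_mul_of_mem_PiXbar l (Subgroup.inv_mem _ ha.1) a
            rw [inv_mul_cancel, SemidirectProduct.one_left] at h
            have h' : Multiplicative.toAdd a⁻¹.left m = -Multiplicative.toAdd a.left m := by
              rw [eq_neg_iff_add_eq_zero, ← Pi.add_apply, ← toAdd_mul, ← h, toAdd_one, Pi.zero_apply]
            rw [h', map_neg, ha.2.1 m, neg_zero],
          by
            have h := right_left_mul l (Subgroup.inv_mem _ ha.1).1 a
            rw [inv_mul_cancel, SemidirectProduct.one_right, SemidirectProduct.one_left] at h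
            have h' : Multiplicative.toAdd a⁻¹.right.left = -Multiplicative.toAdd a.right.left := by
              rw [eq_neg_iff_add_eq_zero, ← toAdd_mul, ← h, toAdd_one]
            rw [h', map_neg, ha.2.2, neg_zero]⟩ }
    have hKmem : ∀ x, x ∈ K ↔ x ∈ PiXm l ⊓ PiCbarm l ∧ (∀ m, PadicInt.toZMod (Multiplicative.toAdd x.left m) = 0) ∧
        PadicInt.toZModPow 2 (Multiplicative.toAdd x.right.left) = 0 := fun x => Iff.rfl
    have hz : Continuous (PadicInt.toZMod : ℤ_[l] → ZMod l) := by
      refine continuous_of_continuousAt_zero (PadicInt.toZMod (p := l)) ?_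
      rw [ContinuousAt, map_zero, nhds_discrete (ZMod l), Filter.tendsto_pure]
      filter_upwards [Metric.ball_mem_nhds (0 : ℤ_[l]) one_pos] with x hx
      rwa [Metric.mem_ball, dist_zero_right, ← PadicInt.mem_nonunits, ← IsLocalRing.mem_maximalIdeal,
        ← PadicInt.ker_toZMod, RingHom.mem_ker] at hx
    have hKclosed : IsClosed (K : Set (P l)) := by
      have hK : (K : Set (P l)) = ((PiXm l ⊓ PiCbarm l : Subgroup (P l)) : Set (P l)) ∩
          ((⋂ m : ZMod l, (fun g : P l => PadicInt.toZMod (Multiplicative.toAdd g.left m)) ⁻¹' {0}) ∩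
            (fun g : P l => PadicInt.toZModPow 2 (Multiplicative.toAdd g.right.left)) ⁻¹' {0}) := by
        ext x
        simp only [Set.mem_inter_iff, Set.mem_iInter, Set.mem_preimage, Set.mem_singleton_iff, SetLike.mem_coe, hKmem]
      rw [hK]
      refine ((PiXm l ⊓ PiCbarm l).isClosed_of_isOpen ((isOpen_PiXm l).inter (isOpen_PiCbarm l))).inter
        ((isClosed_iInter fun m => (isClosed_discrete _).preimage
          (hz.comp ((continuous_apply m).comp (continuous_toAdd.comp (continuous_left_right_P l).1)))).inter
        ((isClosed_discrete _).preimage ((continuous_toZModPow_two l).comp (continuous_toAdd.comp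
          ((Literature.AnabelianGeometry.EtaleTheta.SettingModel.Semidirect.continuous_left (isInducing_D l)).comp
            (continuous_left_right_P l).2)))))
    have hle : (datum l h5).modLKer ≤ K := by
      refine Subgroup.topologicalClosure_minimal _ (sup_le ?_ ?_) hKclosed
      · rw [deltaXbar_eq, Subgroup.commutator_le]
        intro a ha b hb
        rw [commutatorElement_def, commute_of_mem_PiXbar l ha hb, mul_inv_cancel_right, mul_inv_cancel]
        exact K.one_mem
      · rw [Subgroup.closure_le, deltaXbar_eq]
        rintro _ ⟨w, hw, rfl⟩
        obtain ⟨-, hw2⟩ := (mem_PiXbar_iff l w).1 hw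
        rw [decomp_of_mem_PiXm l hw.1]
        change (inN l (Multiplicative.toAdd w.left) * elA l (Multiplicative.toAdd w.right.left)) ^ l ∈ K
        rw [inN_mul_elA_pow l hw2]
        refine ⟨Subgroup.mul_mem _ (inN_mem_PiXbar l _) (elA_mem_PiXbar l (by
          rw [map_mul, map_natCast, ZMod.natCast_self, zero_mul])), fun m => ?_, ?_⟩
        · rw [left_mul_of_mem_PiXbar l (inN_mem_PiXbar l _), inN_left]
          change PadicInt.toZMod (Multiplicative.toAdd (Multiplicative.ofAdd ((l : ℤ_[l]) • Multiplicative.toAdd w.left) *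
            (1 : N l)) m) = 0
          rw [mul_one, toAdd_ofAdd, Pi.smul_apply, smul_eq_mul, map_mul, map_natCast, ZMod.natCast_self, zero_mul]
        · rw [right_left_mul l (inN_mem_PiXbar l _).1, inN_right]
          change PadicInt.toZModPow 2 (Multiplicative.toAdd ((1 : C l) *
            Multiplicative.ofAdd ((l : ℤ_[l]) * Multiplicative.toAdd w.right.left))) = 0
          rw [one_mul, toAdd_ofAdd, toZModPow_two_mul_eq_zero_iff]
          exact hw2
    exact (hKmem g).1 (hle hg)
  · rintro ⟨hgW, hcoord, hs⟩
    obtain ⟨-, hs0⟩ := (mem_PiXbar_iff l g).1 hgW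
    obtain ⟨t, ht⟩ := exists_eq_mul_of_toZMod_eq_zero'' l hs0
    have ht0 : PadicInt.toZMod t = 0 := by rw [ht, toZModPow_two_mul_eq_zero_iff] at hs; exact hs
    choose v' hv' using fun m => exists_eq_mul_of_toZMod_eq_zero'' l (hcoord m)
    have hv : Multiplicative.toAdd g.left = (l : ℤ_[l]) • (fun m => v' m) := by
      funext m; rw [Pi.smul_apply, smul_eq_mul]; exact hv' m
    rw [decomp_of_mem_PiXm l hgW.1, hv, ht, ← inN_mul_elA_pow l ht0]
    refine Subgroup.le_topologicalClosure _ (Subgroup.mem_sup_right (Subgroup.subset_closure ⟨_, ?_, rfl⟩))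
    rw [SetLike.mem_coe, deltaXbar_eq]
    exact Subgroup.mul_mem _ (inN_mem_PiXbar l _) (elA_mem_PiXbar l ht0)

/-- **`[Δ_X̲ : Ker(Δ_X̲ ↠ Δ_X̲^{ab} ⊗ ℤ/l)] = l^{l+1}`** at the pro-`l` datum (`Δ_X̲^{ab} ⊗ ℤ/l ≅ (ℤ/l)^{ℤ/l} × ℤ/l` via
`(v, a^{l t}) ↦ (v mod l, t mod l)`). ([IUTchI] §1 p.37) [claim: Mochizuki2012, status: disputed] -/
theorem modLKer_relIndex_datum (h5 : 5 ≤ l) :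
    (datum l h5).modLKer.relIndex (datum l h5).DeltaXbar = l ^ (l + 1) := by
  classical
  haveI : Fact (1 < l) := ⟨(Fact.out : l.Prime).one_lt⟩
  rw [deltaXbar_eq]
  set W := PiXm l ⊓ PiCbarm l with hW
  -- the homomorphism `W → (ℤ/l)^{ℤ/l} × ℤ/l`
  have hq : ∀ w : W, PadicInt.toZMod (Multiplicative.toAdd w.1.right.left) = 0 := fun w =>
    ((mem_PiXbar_iff l w.1).1 w.2).2
  let f₁ : W →* Multiplicative (ZMod l → ZMod l) := MonoidHom.mk'
    (fun w => Multiplicative.ofAdd fun m => PadicInt.toZMod (Multiplicative.toAdd w.1.left m))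
    (fun a b => by
      rw [← ofAdd_add]; congr 1; funext m
      rw [Pi.add_apply, Subgroup.coe_mul, left_mul_of_mem_PiXbar l a.2, toAdd_mul, Pi.add_apply, map_add])
  let f₂ : W →* Multiplicative (ZMod l) := MonoidHom.mk'
    (fun w => Multiplicative.ofAdd (PadicInt.toZMod (Classical.choose (exists_eq_mul_of_toZMod_eq_zero'' l (hq w)))))
    (fun a b => by
      rw [← ofAdd_add, ← map_add]
      congr 2
      refine quot_unique l (hq (a * b)) ?_
      rw [Subgroup.coe_mul, right_left_mul l a.2.1, toAdd_mul, mul_add, ← quot_spec l (hq a), ← quot_spec l (hq b)])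
  let f : W →* Multiplicative (ZMod l → ZMod l) × Multiplicative (ZMod l) := f₁.prod f₂
  -- kernel
  have hker : f.ker = (datum l h5).modLKer.subgroupOf W := by
    ext w
    rw [MonoidHom.mem_ker, Subgroup.mem_subgroupOf, mem_modLKer_datum_iff, Prod.ext_iff]
    change Multiplicative.ofAdd (fun m => PadicInt.toZMod (Multiplicative.toAdd w.1.left m)) = 1 ∧
      Multiplicative.ofAdd (PadicInt.toZMod (Classical.choose (exists_eq_mul_of_toZMod_eq_zero'' l (hq w)))) = 1 ↔ _
    rw [← ofAdd_zero, ← ofAdd_zero, Multiplicative.ofAdd.injective.eq_iff, Multiplicative.ofAdd.injective.eq_iff,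
      funext_iff]
    have e2 : PadicInt.toZMod (Classical.choose (exists_eq_mul_of_toZMod_eq_zero'' l (hq w))) = 0 ↔
        PadicInt.toZModPow 2 (Multiplicative.toAdd w.1.right.left) = 0 := by
      conv_rhs => rw [quot_spec l (hq w)]
      rw [toZModPow_two_mul_eq_zero_iff]
    rw [e2]
    exact ⟨fun h => ⟨w.2, h.1, h.2⟩, fun h => ⟨h.2.1, h.2.2⟩⟩
  -- surjectivity
  have hsurj : Function.Surjective f := by
    rintro ⟨p, q⟩
    let v : V l := fun m => ((Multiplicative.toAdd p m).val : ℤ_[l])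
    let t : ℤ_[l] := ((Multiplicative.toAdd q).val : ℤ_[l])
    have ht : PadicInt.toZMod ((l : ℤ_[l]) * t) = 0 := by rw [map_mul, map_natCast, ZMod.natCast_self, zero_mul]
    have hmem : inN l v * elA l ((l : ℤ_[l]) * t) ∈ W := Subgroup.mul_mem _ (inN_mem_PiXbar l v) (elA_mem_PiXbar l ht)
    refine ⟨⟨_, hmem⟩, Prod.ext ?_ ?_⟩
    · change Multiplicative.ofAdd (fun m => PadicInt.toZMod (Multiplicative.toAdd (inN l v * elA l _).left m)) = p
      rw [← ofAdd_toAdd p]; congr 1; funext m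
      rw [left_mul_of_mem_PiXbar l (inN_mem_PiXbar l v), inN_left]
      change PadicInt.toZMod (Multiplicative.toAdd (Multiplicative.ofAdd v * (1 : N l)) m) = _
      rw [mul_one, toAdd_ofAdd]
      change PadicInt.toZMod (((Multiplicative.toAdd p m).val : ℤ_[l])) = _
      rw [map_natCast, ZMod.natCast_zmod_val]
    · change Multiplicative.ofAdd (PadicInt.toZMod (Classical.choose (exists_eq_mul_of_toZMod_eq_zero'' l (hq ⟨_, hmem⟩)))) = q
      have hs : Multiplicative.toAdd (inN l v * elA l ((l : ℤ_[l]) * t)).right.left = l * t := by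
        rw [right_left_mul l (inN_mem_PiXbar l v).1, inN_right]
        change Multiplicative.toAdd ((1 : C l) * Multiplicative.ofAdd ((l : ℤ_[l]) * t)) = _
        rw [one_mul, toAdd_ofAdd]
      rw [quot_unique l (hq ⟨_, hmem⟩) hs, map_natCast, ZMod.natCast_zmod_val, ofAdd_toAdd]
  rw [Subgroup.relIndex, ← hker, Subgroup.index_ker, MonoidHom.range_eq_top.mpr hsurj, Subgroup.card_top,
    Nat.card_prod, Nat.card_eq_fintype_card, Fintype.card_multiplicative, ← Nat.card_eq_fintype_card, Nat.card_fun,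
    Nat.card_zmod, Nat.card_eq_fintype_card, Fintype.card_multiplicative, ZMod.card, pow_succ]

end ProLModel

end PuncturedEllipticData

end Literature.IUT.HodgeTheaters
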